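import Summits.Ventures.PercRepro.RankLevelSetLevelSixHeavySq26
import Summits.Ventures.PercRepro.RankLevelSetLevelFiveSharpXXI

/-!
# PercRepro — C-025 AT LEVEL `6` FOR EVERY `p ≥ 26`, EVERY FINITE MATROID, UNCONDITIONAL (p8 g7, S3)

`proofs/SUBCLAIM-S3-p8.md` §3u (THE 26 ROW, on the nullity-4 cap 16). `c025_six_of_five_heavy_sq26` (RankLevelSetLevelSixHeavySq26: the coloop-free averaging step on the chain from the nullity-4 cap `16` and the coloop split at rank `26`, the `27` row beyond) on p7's level-`5` row `c025_five_large_sharp21 (21 ≤ p)` (RankLevelSetLevelFiveSharpXXI). One line. Axioms: standard.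
-/

open scoped Matroid

namespace PercRepro

namespace ThmN

open Set

variable {α : Type}

/-- **C-025 AT LEVEL `6` FOR EVERY `p ≥ 26`, EVERY FINITE MATROID, UNCONDITIONAL** — `c025_six_of_five_heavy_sq26` on
p7's level-`5` row `c025_five_large_sharp21 (21 ≤ p)`. -/
theorem c025_six_large_twenty_six (M : Matroid α) [M.Finite] (p : ℕ) (hp : 26 ≤ p) : RLS M p 6 :=
  c025_six_of_five_heavy_sq26 (fun M _ p hp => c025_five_large_sharp21 M p (by omega)) M p hp

/-- The same in the vocabulary of `C025`: the level-`6` frontier is every `p ≥ 26`. -/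
theorem c025_six_large_twenty_six' (M : Matroid α) [M.Finite] (p : ℕ) (hp : 26 ≤ p) :
    phiK p 6 * ({A : Set α | A ⊆ M.E ∧ M.eRk A = (p : ℕ∞) ∧ M.eRk (M.E \ A) = (6 : ℕ∞)}.ncard : ℚ) ≤
      ({A : Set α | A ⊆ M.E ∧ (6 : ℕ∞) < M.eRk A ∧ M.eRk A < (p : ℕ∞)}.ncard : ℚ) :=
  c025_six_large_twenty_six M p hp
end ThmN

end PercRepro
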